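import Summits.CriticalPhenomena.Ising3DConformalLimit.Theorems.PrecisionLaplacianDirectCorrelationStableTailSpectralShellBound
import Summits.CriticalPhenomena.Ising3DConformalLimit.Theorems.PrecisionLaplacianDirectCorrelationStableTailFluxPositivity
import Summits.CriticalPhenomena.Ising3DConformalLimit.Theorems.PrecisionLaplacianDirectCorrelationStableTailNonSaturationOfHeavyTail
import Summits.CriticalPhenomena.Ising3DConformalLimit.Theorems.PrecisionLaplacianPrecisionIsLaplacian
import Summits.CriticalPhenomena.Ising3DConformalLimit.Theorems.PrecisionLaplacianDirectCorrelationStableTailDiffusiveBranch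
import Summits.CriticalPhenomena.Ising3DConformalLimit.Theses.PerfectScreening
import Literature.Probability.LatticeModels.CriticalTwoPointLower
import HarnessLib

/-!
# Superdiffusivity of the OZ step law forces non-saturation — D2 of line `diffusive-branch-is-nonsaturation`,
# crux `PrecisionLaplacian.DirectCorrelationStableTail` (stmt-CriticalPhenomena-4799)

Pure theorem file (no definitions).  `stub_nonSaturationOfInfiniteVariance`: under the symmetric-potential hypothesis `H`,
if the critical direct correlation function `a(x) = inf_{A ∋ 0,x} −(G_A)⁻¹(0,x)` of the 3-d Ising model has infinite second
moment then the infrared bound is NOT saturated along the axis (item 1342); with the landed S1 (p127888):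
`H → (NonSaturation ↔ Σ_x a(x)|x|² = ∞)` (`nonSaturation_iff_infiniteVariance`).  Proof: the two-scale shell bound
(`spectralShell_level`, p129261) in the limit `L → ∞`, saturation `Σ_{Λ_R²} G ≳ ε(2R+1)⁵` (stub E) with `R ≍ (2R'+1)/ε`,
`ρ₁ ≍ ε/(2R'+1)` ⇒ `D(y) = ½⟨v,Gv⟩ ≥ κ(ε)(2R'+1)³|y|²`; the flux identity (stub H) caps `Σ_{y∈Λ_{R'}} a(y)D(y) ≤ (2R'+1)³`.
-/

noncomputable section

namespace Summit.CriticalPhenomena.Ising3DConformalLimit.Cruxes.DirectCorrelationStableTail.DiffusiveBranchIsNonsaturation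

open MeasureTheory Filter Topology
open Literature.Probability.LatticeModels
open Summit.CriticalPhenomena.Ising3DConformalLimit.Theses

/-! ### The shell bound in the limit `L → ∞` -/

/-- **The two-scale shell bound** (limit `L → ∞` of `spectralShell_level`, using `#{z'−z = w}/(2L+1)³ → 1`). [folklore] -/
theorem spectralShell_quadForm_lower (G : Site 3 → ℝ) (C₀ : ℝ) (hC₀ : 0 ≤ C₀)
    (hGnn : ∀ w, 0 ≤ G w) (hGle : ∀ w, G w ≤ 1) (hGev : ∀ w, G (-w) = G w)
    (hGperm : ∀ (σ : Equiv.Perm (Fin 3)) (x : Site 3), G (fun i => x (σ i)) = G x)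
    (hGflip : ∀ (j : Fin 3) (x : Site 3), G (Function.update x j (-x j)) = G x)
    (hGenv : ∀ w : Site 3, w ≠ 0 → G w ≤ C₀ / (Site.supNorm w : ℝ))
    (hpos : ∀ (A : Finset (Site 3)) (c : Site 3 → ℝ), 0 ≤ ∑ x ∈ A, ∑ x' ∈ A, c x * c x' * G (x' - x))
    (R' R : ℕ) (hR' : 1 ≤ R') (y : Site 3) (hy : Site.supNorm y ≤ R') (ρ₁ : ℝ) (hρ₁ : 0 < ρ₁)
    (hρ₁₂ : ρ₁ ≤ 1 / (2 * (R' : ℝ) + 1)) :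
    (1 / 160) * (2 * (R' : ℝ) + 1) ^ 6 * ((∑ i, ((y i : ℤ) : ℝ) ^ 2) / 3) * ρ₁ ^ 2 *
        (((2 * Real.pi) ^ 3 * (∑ x ∈ box 3 R, ∑ x' ∈ box 3 R, G (x' - x))
          - (40 * (64 * (2 * Real.pi) ^ 3 * (54 * C₀ + 2)) + 60 * (2 * Real.pi) ^ 3) *
              (2 * (R : ℝ) + 1) ^ 4 * (2 * (R' : ℝ) + 1)) / (2 * (R : ℝ) + 1) ^ 6
          - (64 * (2 * Real.pi) ^ 3 * (54 * C₀ + 2)) * ρ₁)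
      ≤ (2 * Real.pi) ^ 3 * ∑ x ∈ (box 3 R' ∪ (box 3 R').image (· + y)),
          ∑ x' ∈ (box 3 R' ∪ (box 3 R').image (· + y)),
            ((if x ∈ box 3 R' then (1 : ℝ) else 0) - (if x - y ∈ box 3 R' then (1 : ℝ) else 0)) *
            ((if x' ∈ box 3 R' then (1 : ℝ) else 0) - (if x' - y ∈ box 3 R' then (1 : ℝ) else 0)) *
            G (x' - x) := by
  -- abbreviations
  set S : Finset (Site 3) := box 3 R' ∪ (box 3 R').image (· + y) with hS
  set v : Site 3 → ℝ := fun x =>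
    (if x ∈ box 3 R' then (1 : ℝ) else 0) - (if x - y ∈ box 3 R' then (1 : ℝ) else 0) with hv
  set c₁ : ℝ := (1 / 160) * (2 * (R' : ℝ) + 1) ^ 6 * ((∑ i, ((y i : ℤ) : ℝ) ^ 2) / 3) * ρ₁ ^ 2 with hc₁
  set Ctl : ℝ := (40 * (64 * (2 * Real.pi) ^ 3 * (54 * C₀ + 2)) + 60 * (2 * Real.pi) ^ 3) *
    (2 * (R : ℝ) + 1) ^ 4 * (2 * (R' : ℝ) + 1) with hCtl
  set CM : ℝ := (64 * (2 * Real.pi) ^ 3 * (54 * C₀ + 2)) * ρ₁ with hCMdef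
  set r : ℕ → Site 3 → ℝ := fun L w =>
    ((((box 3 L) ×ˢ (box 3 L)).filter (fun p : Site 3 × Site 3 => p.2 - p.1 = w)).card : ℝ) /
      ((2 * (L : ℝ) + 1) ^ 3) with hr
  -- the level-`L` inequality, divided by `(2L+1)³`
  have hlevel : ∀ L : ℕ,
      c₁ * (((2 * Real.pi) ^ 3 * (∑ x ∈ box 3 R, ∑ x' ∈ box 3 R, G (x' - x) * r L (x' - x)) - Ctl)
          / (2 * (R : ℝ) + 1) ^ 6 - CM)
        ≤ (2 * Real.pi) ^ 3 * ∑ x ∈ S, ∑ x' ∈ S, v x * v x' * G (x' - x) * r L (x' - x) := by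
    intro L
    have h := spectralShell_level G C₀ hC₀ hGnn hGle hGev hGperm hGflip hGenv hpos R' R L hR' y hy ρ₁ hρ₁ hρ₁₂
    have hNL : (0 : ℝ) < (2 * (L : ℝ) + 1) ^ 3 := by positivity
    -- rewrite both sides as `(2L+1)³ ×` the divided expressions
    have e1 : ∑ x ∈ box 3 R, ∑ x' ∈ box 3 R, G (x' - x) *
          ((((box 3 L) ×ˢ (box 3 L)).filter (fun p : Site 3 × Site 3 => p.2 - p.1 = x' - x)).card : ℝ)
        = (2 * (L : ℝ) + 1) ^ 3 * ∑ x ∈ box 3 R, ∑ x' ∈ box 3 R, G (x' - x) * r L (x' - x) := by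
      rw [Finset.mul_sum]
      refine Finset.sum_congr rfl fun x _ => ?_
      rw [Finset.mul_sum]
      refine Finset.sum_congr rfl fun x' _ => ?_
      simp only [hr]
      field_simp
    have e2 : ∑ x ∈ S, ∑ x' ∈ S, v x * v x' * G (x' - x) *
          ((((box 3 L) ×ˢ (box 3 L)).filter (fun p : Site 3 × Site 3 => p.2 - p.1 = x' - x)).card : ℝ)
        = (2 * (L : ℝ) + 1) ^ 3 * ∑ x ∈ S, ∑ x' ∈ S, v x * v x' * G (x' - x) * r L (x' - x) := by
      rw [Finset.mul_sum]
      refine Finset.sum_congr rfl fun x _ => ?_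
      rw [Finset.mul_sum]
      refine Finset.sum_congr rfl fun x' _ => ?_
      simp only [hr]
      field_simp
    simp only [hS, hv] at e2
    rw [e1, e2] at h
    have h' : (2 * (L : ℝ) + 1) ^ 3 * (c₁ * (((2 * Real.pi) ^ 3 *
          (∑ x ∈ box 3 R, ∑ x' ∈ box 3 R, G (x' - x) * r L (x' - x)) - Ctl) / (2 * (R : ℝ) + 1) ^ 6 - CM))
        ≤ (2 * (L : ℝ) + 1) ^ 3 * ((2 * Real.pi) ^ 3 * ∑ x ∈ S, ∑ x' ∈ S, v x * v x' * G (x' - x) * r L (x' - x)) := by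
      have eL : c₁ * (((2 * Real.pi) ^ 3 * ((2 * (L : ℝ) + 1) ^ 3 *
              ∑ x ∈ box 3 R, ∑ x' ∈ box 3 R, G (x' - x) * r L (x' - x))
            - (40 * (64 * (2 * Real.pi) ^ 3 * (54 * C₀ + 2)) + 60 * (2 * Real.pi) ^ 3) *
                (2 * (R : ℝ) + 1) ^ 4 * (2 * (R' : ℝ) + 1) * (2 * (L : ℝ) + 1) ^ 3) / (2 * (R : ℝ) + 1) ^ 6
            - (64 * (2 * Real.pi) ^ 3 * (54 * C₀ + 2)) * ρ₁ * (2 * (L : ℝ) + 1) ^ 3)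
          = (2 * (L : ℝ) + 1) ^ 3 * (c₁ * (((2 * Real.pi) ^ 3 *
              (∑ x ∈ box 3 R, ∑ x' ∈ box 3 R, G (x' - x) * r L (x' - x)) - Ctl) / (2 * (R : ℝ) + 1) ^ 6 - CM)) := by
        rw [hCtl, hCMdef]
        field_simp
      have eR : (2 * Real.pi) ^ 3 * ((2 * (L : ℝ) + 1) ^ 3 *
            ∑ x ∈ S, ∑ x' ∈ S, v x * v x' * G (x' - x) * r L (x' - x))
          = (2 * (L : ℝ) + 1) ^ 3 * ((2 * Real.pi) ^ 3 *
            ∑ x ∈ S, ∑ x' ∈ S, v x * v x' * G (x' - x) * r L (x' - x)) := by ring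
      rw [← eL, ← eR]
      simpa only [hc₁, hS, hv] using h
    exact le_of_mul_le_mul_left h' hNL
  -- limits
  have hr1 : ∀ w : Site 3, Tendsto (fun L : ℕ => r L w) atTop (𝓝 1) := fun w => (stub_autocorrelationCount w).2.2
  have hA : Tendsto (fun L : ℕ => c₁ * (((2 * Real.pi) ^ 3 *
        (∑ x ∈ box 3 R, ∑ x' ∈ box 3 R, G (x' - x) * r L (x' - x)) - Ctl) / (2 * (R : ℝ) + 1) ^ 6 - CM))
      atTop (𝓝 (c₁ * (((2 * Real.pi) ^ 3 *
        (∑ x ∈ box 3 R, ∑ x' ∈ box 3 R, G (x' - x) * 1) - Ctl) / (2 * (R : ℝ) + 1) ^ 6 - CM))) := by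
    refine Tendsto.const_mul _ (Tendsto.sub (Tendsto.div_const (Tendsto.sub (Tendsto.const_mul _ ?_)
      tendsto_const_nhds) _) tendsto_const_nhds)
    exact tendsto_finsetSum _ fun x _ => tendsto_finsetSum _ fun x' _ => Tendsto.const_mul _ (hr1 _)
  have hB : Tendsto (fun L : ℕ => (2 * Real.pi) ^ 3 * ∑ x ∈ S, ∑ x' ∈ S, v x * v x' * G (x' - x) * r L (x' - x))
      atTop (𝓝 ((2 * Real.pi) ^ 3 * ∑ x ∈ S, ∑ x' ∈ S, v x * v x' * G (x' - x) * 1)) := by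
    refine Tendsto.const_mul _ ?_
    exact tendsto_finsetSum _ fun x _ => tendsto_finsetSum _ fun x' _ => Tendsto.const_mul _ (hr1 _)
  have key := le_of_tendsto_of_tendsto' hA hB hlevel
  simp only [mul_one] at key
  simpa only [hc₁, hCtl, hCMdef, hS, hv] using key

/-! ### Positivity of the finite quadratic forms from `H` -/

/-- A positive definite kernel matrix has nonnegative finite quadratic forms (in `Finset` form). [folklore] -/
theorem quadForm_nonneg_of_posDef (G : Site 3 → ℝ)
    (hPD : ∀ A : Finset (Site 3), (Matrix.of fun (p q : ↥A) => G (q.1 - p.1)).PosDef)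
    (A : Finset (Site 3)) (c : Site 3 → ℝ) :
    0 ≤ ∑ x ∈ A, ∑ x' ∈ A, c x * c x' * G (x' - x) := by
  have h0 := (hPD A).posSemidef.dotProduct_mulVec_nonneg (fun p : ↥A => c p.1)
  simp only [star_trivial] at h0
  have e : dotProduct (fun p : ↥A => c p.1)
      ((Matrix.of fun (p q : ↥A) => G (q.1 - p.1)).mulVec fun p : ↥A => c p.1)
        = ∑ x ∈ A, ∑ x' ∈ A, c x * c x' * G (x' - x) := by
    rw [← Finset.sum_coe_sort A]
    refine Finset.sum_congr rfl fun p _ => ?_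
    rw [← Finset.sum_coe_sort A]
    simp only [Matrix.mulVec, dotProduct, Matrix.of_apply, Finset.mul_sum]
    exact Finset.sum_congr rfl fun q _ => by ring
  rw [← e]
  exact h0

/-! ### The quadratic form under saturation -/
set_option maxHeartbeats 400000 in -- buildfix (bf3-g27): 160k/180k FAIL, 200k PASS at accept time; line-neutral budget line
/-- **Under saturation the shifted-box quadratic form is `≳ (2R'+1)³|y|²`.**  With `R = M₀(2R'+1) + 4N + 4`,
`M₀ = ⌈1024 C_tl/((2π)³ε)⌉`, the saturation lower bound `ε(2R+1)⁵ ≤ 512 Σ_{Λ_R²} G` (stub E) makes the main term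
dominate the tail, and `ρ₁ = (2π)³ε/(2048 Γ C_M (2R'+1))`, `Γ = 2M₀ + 8N + 9`, balances the small-cube mass. [folklore] -/
theorem quadForm_lower_of_saturation (G : Site 3 → ℝ) (C₀ ε : ℝ) (N : ℕ) (hC₀ : 0 ≤ C₀) (hε : 0 < ε) (hε1 : ε ≤ 1)
    (hGnn : ∀ w, 0 ≤ G w) (hGle : ∀ w, G w ≤ 1) (hGev : ∀ w, G (-w) = G w)
    (hGperm : ∀ (σ : Equiv.Perm (Fin 3)) (x : Site 3), G (fun i => x (σ i)) = G x)
    (hGflip : ∀ (j : Fin 3) (x : Site 3), G (Function.update x j (-x j)) = G x)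
    (hGenv : ∀ w : Site 3, w ≠ 0 → G w ≤ C₀ / (Site.supNorm w : ℝ))
    (hpos : ∀ (A : Finset (Site 3)) (c : Site 3 → ℝ), 0 ≤ ∑ x ∈ A, ∑ x' ∈ A, c x * c x' * G (x' - x))
    (hsat : ∀ w : Site 3, N ≤ Site.supNorm w → ε ≤ 3 * (Site.supNorm w : ℝ) * G w) :
    ∃ κ : ℝ, 0 < κ ∧ ∀ (R' : ℕ) (y : Site 3), 1 ≤ R' → Site.supNorm y ≤ R' →
      κ * (2 * (R' : ℝ) + 1) ^ 3 * (∑ i, ((y i : ℤ) : ℝ) ^ 2) ≤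
        ∑ x ∈ (box 3 R' ∪ (box 3 R').image (· + y)), ∑ x' ∈ (box 3 R' ∪ (box 3 R').image (· + y)),
          ((if x ∈ box 3 R' then (1 : ℝ) else 0) - (if x - y ∈ box 3 R' then (1 : ℝ) else 0)) *
          ((if x' ∈ box 3 R' then (1 : ℝ) else 0) - (if x' - y ∈ box 3 R' then (1 : ℝ) else 0)) *
          G (x' - x) := by
  -- the constants, kept opaque
  have hπ3 : (3 : ℝ) < Real.pi := Real.pi_gt_three
  obtain ⟨P, hP⟩ : ∃ P : ℝ, (2 * Real.pi) ^ 3 = P := ⟨_, rfl⟩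
  have hPpos : 0 < P := by rw [← hP]; positivity
  have hP1 : 1 ≤ P := by rw [← hP]; exact one_le_pow₀ (by linarith)
  obtain ⟨CM, hCM⟩ : ∃ CM : ℝ, 64 * P * (54 * C₀ + 2) = CM := ⟨_, rfl⟩
  have hCMpos : 0 < CM := by rw [← hCM]; positivity
  have hCM128 : 128 * P ≤ CM := by rw [← hCM]; nlinarith [mul_nonneg hPpos.le hC₀]
  obtain ⟨Ctl, hCtl⟩ : ∃ Ctl : ℝ, 40 * CM + 60 * P = Ctl := ⟨_, rfl⟩
  have hCtlpos : 0 < Ctl := by rw [← hCtl]; positivity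
  obtain ⟨M₀, hM₀def⟩ : ∃ M₀ : ℕ, ⌈1024 * Ctl / (P * ε)⌉₊ = M₀ := ⟨_, rfl⟩
  have hM₀' : 1024 * Ctl ≤ (M₀ : ℝ) * (P * ε) := by
    have h : 1024 * Ctl / (P * ε) ≤ M₀ := by rw [← hM₀def]; exact Nat.le_ceil _
    rwa [div_le_iff₀ (by positivity)] at h
  obtain ⟨Γ, hΓ⟩ : ∃ Γ : ℝ, 2 * (M₀ : ℝ) + 8 * N + 9 = Γ := ⟨_, rfl⟩
  have hM₀nn : (0 : ℝ) ≤ M₀ := Nat.cast_nonneg _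
  have hNnn : (0 : ℝ) ≤ N := Nat.cast_nonneg _
  have hΓpos : 0 < Γ := by rw [← hΓ]; positivity
  have hΓ9 : 9 ≤ Γ := by rw [← hΓ]; linarith
  have hPΓ : P ≤ 2048 * Γ * CM := by
    have h2 : (9 : ℝ) * (128 * P) ≤ Γ * CM := mul_le_mul hΓ9 hCM128 (by positivity) hΓpos.le
    nlinarith
  obtain ⟨τ, hτ⟩ : ∃ τ : ℝ, P * ε / (2048 * Γ * CM) = τ := ⟨_, rfl⟩
  have hτpos : 0 < τ := by rw [← hτ]; positivity
  have hτle : τ ≤ 1 := by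
    rw [← hτ, div_le_one (by positivity)]
    have : P * ε ≤ P := by nlinarith
    linarith
  refine ⟨(1 / 160) * (1 / 3) * τ ^ 2 * (P * ε / (2048 * Γ)) / P, by positivity, ?_⟩
  intro R' y hR' hy
  have hR'pos : (0 : ℝ) < 2 * (R' : ℝ) + 1 := by positivity
  have hR'1 : (1 : ℝ) ≤ 2 * (R' : ℝ) + 1 := by linarith [(Nat.cast_nonneg R' : (0 : ℝ) ≤ R')]
  -- the auxiliary box and the scales
  obtain ⟨R, hRdef⟩ : ∃ R : ℕ, M₀ * (2 * R' + 1) + 4 * N + 4 = R := ⟨_, rfl⟩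
  have hR4N : 4 * N ≤ R := by
    rw [← hRdef]; exact (Nat.le_add_left (4 * N) (M₀ * (2 * R' + 1))).trans (Nat.le_add_right _ 4)
  have hR4 : 4 ≤ R := by rw [← hRdef]; exact Nat.le_add_left 4 _
  have hRreal : (2 * (R : ℝ) + 1) = 2 * (M₀ : ℝ) * (2 * R' + 1) + 8 * N + 9 := by
    rw [← hRdef]; push_cast; ring
  obtain ⟨ρ₁, hρ₁⟩ : ∃ ρ₁ : ℝ, τ / (2 * (R' : ℝ) + 1) = ρ₁ := ⟨_, rfl⟩
  have hρ₁pos : 0 < ρ₁ := by rw [← hρ₁]; positivity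
  have hρ₁le : ρ₁ ≤ 1 / (2 * (R' : ℝ) + 1) := by
    rw [← hρ₁]; exact div_le_div_of_nonneg_right hτle hR'pos.le
  -- the two inputs: saturation (stub E) and the shell bound
  have hE := (stub_boxDoubleSumBounds G hGnn).2 ε N hε.le hsat R hR4N hR4
  have hshell := spectralShell_quadForm_lower G C₀ hC₀ hGnn hGle hGev hGperm hGflip hGenv hpos R' R hR' y hy ρ₁
    hρ₁pos hρ₁le
  rw [hP, hCM, hCtl] at hshell
  -- make everything scalar
  generalize hX : (2 * (R : ℝ) + 1) = X at hE hshell hRreal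
  generalize hT : (2 * (R' : ℝ) + 1) = T at hshell hRreal hR'pos hR'1 hρ₁ ⊢
  generalize hS : (∑ x ∈ box 3 R, ∑ x' ∈ box 3 R, G (x' - x)) = S at hE hshell
  generalize hY : (∑ i, ((y i : ℤ) : ℝ) ^ 2) = Y at hshell ⊢
  generalize hQ : (∑ x ∈ (box 3 R' ∪ (box 3 R').image (· + y)), ∑ x' ∈ (box 3 R' ∪ (box 3 R').image (· + y)),
          ((if x ∈ box 3 R' then (1 : ℝ) else 0) - (if x - y ∈ box 3 R' then (1 : ℝ) else 0)) *
          ((if x' ∈ box 3 R' then (1 : ℝ) else 0) - (if x' - y ∈ box 3 R' then (1 : ℝ) else 0)) *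
          G (x' - x)) = Q at hshell ⊢
  have hY0 : 0 ≤ Y := by rw [← hY]; positivity
  have hXpos : 0 < X := by rw [hRreal]; positivity
  have hXlow : (M₀ : ℝ) * T ≤ X := by
    rw [hRreal]; nlinarith
  have hXup : X ≤ Γ * T := by
    rw [hRreal, ← hΓ]; nlinarith
  -- main ≥ 2·tail:  Ctl X⁴ T ≤ P ε X⁵ / 1024
  have hdom : Ctl * X ^ 4 * T ≤ P * ε * X ^ 5 / 1024 := by
    have h2 : 1024 * Ctl * T ≤ P * ε * X := by
      calc 1024 * Ctl * T ≤ (M₀ : ℝ) * (P * ε) * T := mul_le_mul_of_nonneg_right hM₀' (by linarith)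
        _ = P * ε * ((M₀ : ℝ) * T) := by ring
        _ ≤ P * ε * X := mul_le_mul_of_nonneg_left hXlow (by positivity)
    have h4 : (0 : ℝ) ≤ X ^ 4 := by positivity
    rw [le_div_iff₀ (by norm_num : (0 : ℝ) < 1024)]
    calc Ctl * X ^ 4 * T * 1024 = (1024 * Ctl * T) * X ^ 4 := by ring
      _ ≤ (P * ε * X) * X ^ 4 := mul_le_mul_of_nonneg_right h2 h4
      _ = P * ε * X ^ 5 := by ring
  -- the bracket is ≥ (Pε/(2048 Γ))/T
  have hbr : P * ε / (2048 * Γ) / T ≤ (P * S - Ctl * X ^ 4 * T) / X ^ 6 - CM * ρ₁ := by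
    have h1 : P * ε * X ^ 5 / 1024 ≤ P * S - Ctl * X ^ 4 * T := by
      have : P * (ε * X ^ 5) ≤ P * (512 * S) := mul_le_mul_of_nonneg_left hE hPpos.le
      linarith
    have h2 : P * ε / (1024 * X) ≤ (P * S - Ctl * X ^ 4 * T) / X ^ 6 := by
      rw [div_le_div_iff₀ (by positivity) (by positivity)]
      have e : P * ε * X ^ 6 = (P * ε * X ^ 5 / 1024) * (1024 * X) := by
        field_simp
      rw [e]
      exact mul_le_mul_of_nonneg_right h1 (by positivity)
    have h3 : P * ε / (1024 * (Γ * T)) ≤ P * ε / (1024 * X) :=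
      div_le_div_of_nonneg_left (by positivity) (by positivity) (by linarith [hXup])
    have h4 : CM * ρ₁ = P * ε / (2048 * Γ) / T := by
      rw [← hρ₁, ← hτ]; field_simp
    have h5 : P * ε / (2048 * Γ) / T = P * ε / (1024 * (Γ * T)) - P * ε / (2048 * Γ) / T := by
      field_simp; ring
    rw [h4]
    linarith
  -- combine with the shell bound
  have hc₁nn : (0 : ℝ) ≤ (1 / 160) * T ^ 6 * (Y / 3) * ρ₁ ^ 2 := by positivity
  have hmain : (1 / 160) * T ^ 6 * (Y / 3) * ρ₁ ^ 2 * (P * ε / (2048 * Γ) / T) ≤ P * Q :=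
    (mul_le_mul_of_nonneg_left hbr hc₁nn).trans hshell
  have e : (1 / 160) * (1 / 3) * τ ^ 2 * (P * ε / (2048 * Γ)) / P * T ^ 3 * Y
      = ((1 / 160) * T ^ 6 * (Y / 3) * ρ₁ ^ 2 * (P * ε / (2048 * Γ) / T)) / P := by
    rw [← hρ₁]; field_simp
  rw [e, div_le_iff₀ hPpos]
  linarith

/-! ### Finite variance under saturation (abstract) -/

/-- **Saturation forces finite second moment of the precision row** (abstract form): `a ∈ ℓ¹`, `Σ a = 0`,
`a ≥ 0` off `0`, `a ∗ G = −δ₀`, and `G` as above with saturation `ε ≤ 3‖w‖G(w)` for `‖w‖ ≥ N` imply that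
`Σ_x a(x)|x|₂²` converges (partial sums over boxes are bounded by `2/κ` via the flux bound of stub H). [folklore] -/
theorem summable_sq_of_saturation (a G : Site 3 → ℝ) (C₀ ε : ℝ) (N : ℕ) (hC₀ : 0 ≤ C₀) (hε : 0 < ε) (hε1 : ε ≤ 1)
    (hsum : Summable a) (hzero : (∑' y, a y) = 0) (hnn : ∀ y, y ≠ 0 → 0 ≤ a y)
    (hconv : ∀ z : Site 3, (∑' y, a y * G (z - y)) = if z = 0 then -1 else 0)
    (hGnn : ∀ w, 0 ≤ G w) (hGle : ∀ w, G w ≤ 1) (hGev : ∀ w, G (-w) = G w)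
    (hGperm : ∀ (σ : Equiv.Perm (Fin 3)) (x : Site 3), G (fun i => x (σ i)) = G x)
    (hGflip : ∀ (j : Fin 3) (x : Site 3), G (Function.update x j (-x j)) = G x)
    (hGenv : ∀ w : Site 3, w ≠ 0 → G w ≤ C₀ / (Site.supNorm w : ℝ))
    (hpos : ∀ (A : Finset (Site 3)) (c : Site 3 → ℝ), 0 ≤ ∑ x ∈ A, ∑ x' ∈ A, c x * c x' * G (x' - x))
    (hsat : ∀ w : Site 3, N ≤ Site.supNorm w → ε ≤ 3 * (Site.supNorm w : ℝ) * G w) :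
    Summable (fun x : Site 3 => a x * ∑ j, ((x j : ℤ) : ℝ) ^ 2) := by
  obtain ⟨κ, hκ, hquad⟩ := quadForm_lower_of_saturation G C₀ ε N hC₀ hε hε1 hGnn hGle hGev hGperm hGflip hGenv
    hpos hsat
  have habs : ∀ w, |G w| ≤ 1 := fun w => abs_le.2 ⟨by linarith [hGnn w], hGle w⟩
  -- nonnegativity of the summand
  have hf0 : ∀ x : Site 3, 0 ≤ a x * ∑ j, ((x j : ℤ) : ℝ) ^ 2 := by
    intro x
    by_cases hx : x = 0
    · subst hx; simp
    · exact mul_nonneg (hnn x hx) (by positivity)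
  -- bounded partial sums over boxes
  have hbox : ∀ R' : ℕ, 1 ≤ R' → ∑ x ∈ box 3 R', a x * ∑ j, ((x j : ℤ) : ℝ) ^ 2 ≤ 2 / κ := by
    intro R' hR'
    have hR'pos : (0 : ℝ) < (2 * (R' : ℝ) + 1) ^ 3 := by positivity
    obtain ⟨hflux, hD⟩ := stub_fluxPositivity a G R' (box 3 R') hsum hzero hnn habs hGev hconv hpos
    -- termwise: a y · κ (2R'+1)³ |y|² ≤ 2 · a y · D(y)
    have hterm : ∀ y ∈ box 3 R', a y * (κ * (2 * (R' : ℝ) + 1) ^ 3 * ∑ j, ((y j : ℤ) : ℝ) ^ 2) ≤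
        2 * (a y * ∑ b ∈ box 3 R', ∑ b' ∈ box 3 R', (G (b' - b) - G (b' - b - y))) := by
      intro y hyb
      by_cases hy0 : y = 0
      · subst hy0; simp
      · have hyR : Site.supNorm y ≤ R' := mem_box_iff_supNorm_le.1 hyb
        have h1 := hquad R' y hR' hyR
        rw [hD y]
        have h2 : a y * (κ * (2 * (R' : ℝ) + 1) ^ 3 * ∑ j, ((y j : ℤ) : ℝ) ^ 2) ≤ a y * _ :=
          mul_le_mul_of_nonneg_left h1 (hnn y hy0)
        calc _ ≤ _ := h2
          _ = _ := by ring
    have h3 : ∑ y ∈ box 3 R', a y * (κ * (2 * (R' : ℝ) + 1) ^ 3 * ∑ j, ((y j : ℤ) : ℝ) ^ 2) ≤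
        2 * (2 * (R' : ℝ) + 1) ^ 3 := by
      calc _ ≤ ∑ y ∈ box 3 R', 2 * (a y * ∑ b ∈ box 3 R', ∑ b' ∈ box 3 R', (G (b' - b) - G (b' - b - y))) :=
            Finset.sum_le_sum hterm
        _ = 2 * ∑ y ∈ box 3 R', a y * ∑ b ∈ box 3 R', ∑ b' ∈ box 3 R', (G (b' - b) - G (b' - b - y)) := by
            rw [Finset.mul_sum]
        _ ≤ 2 * (2 * (R' : ℝ) + 1) ^ 3 := by linarith
    have h4 : ∑ y ∈ box 3 R', a y * (κ * (2 * (R' : ℝ) + 1) ^ 3 * ∑ j, ((y j : ℤ) : ℝ) ^ 2) =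
        (κ * (2 * (R' : ℝ) + 1) ^ 3) * ∑ y ∈ box 3 R', a y * ∑ j, ((y j : ℤ) : ℝ) ^ 2 := by
      rw [Finset.mul_sum]
      exact Finset.sum_congr rfl fun y _ => by ring
    rw [h4] at h3
    have h5 : κ * ∑ y ∈ box 3 R', a y * ∑ j, ((y j : ℤ) : ℝ) ^ 2 ≤ 2 := by
      refine le_of_mul_le_mul_right ?_ hR'pos
      calc κ * (∑ y ∈ box 3 R', a y * ∑ j, ((y j : ℤ) : ℝ) ^ 2) * (2 * (R' : ℝ) + 1) ^ 3
          = κ * (2 * (R' : ℝ) + 1) ^ 3 * ∑ y ∈ box 3 R', a y * ∑ j, ((y j : ℤ) : ℝ) ^ 2 := by ring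
        _ ≤ 2 * (2 * (R' : ℝ) + 1) ^ 3 := h3
    rw [le_div_iff₀ hκ]
    linarith [mul_comm κ (∑ y ∈ box 3 R', a y * ∑ j, ((y j : ℤ) : ℝ) ^ 2)]
  -- every finite set sits in a box
  refine summable_of_sum_le hf0 (c := 2 / κ) fun u => ?_
  obtain ⟨R', hR'1, hu⟩ : ∃ R' : ℕ, 1 ≤ R' ∧ u ⊆ box 3 R' := by
    refine ⟨max 1 (u.sup Site.supNorm), le_max_left _ _, fun x hx => ?_⟩
    rw [mem_box_iff_supNorm_le]
    exact (Finset.le_sup hx).trans (le_max_right _ _)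
  exact (Finset.sum_le_sum_of_subset_of_nonneg hu fun x _ _ => hf0 x).trans (hbox R' hR'1)

/-! ### The Ising instance -/

/-- **D2 `stub_nonSaturationOfInfiniteVariance`: under `H`, superdiffusivity of the OZ step law forces
non-saturation of the infrared bound (item 1342).**  Contrapositive of `summable_sq_of_saturation` at
`G = criticalTwoPoint 3`: `L` from item 4803, positivity from `H`, the envelope `G ≤ C₀/‖x‖`
(`exists_criticalTwoPoint_le_inv_pow`), hyperoctahedral invariance (`twoPointPlus_perm_invariant_holds`,
`twoPointPlus_reflection_invariant_holds`) and axis ⇒ pointwise saturation (`nonSatHeavyTail_pointwise`, MMS).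
[folklore] -/
theorem stub_nonSaturationOfInfiniteVariance :
    (∀ A : Finset (Site 3), (Matrix.of fun (p q : ↥A) => criticalTwoPoint 3 (q.1 - p.1)).PosDef ∧ ∀ u v : ↥A,
      (u ≠ v → (Matrix.of fun (p q : ↥A) => criticalTwoPoint 3 (q.1 - p.1))⁻¹ u v ≤ 0) ∧ 0 ≤ ∑ w, (Matrix.of
      fun (p q : ↥A) => criticalTwoPoint 3 (q.1 - p.1))⁻¹ u w) →
    ¬ Summable (fun x : Site 3 => (⨅ A : {A : Finset (Site 3) // (0 : Site 3) ∈ A ∧ x ∈ A}, -((Matrix.of fun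
      (p q : ↥A.1) => criticalTwoPoint 3 (q.1 - p.1))⁻¹ ⟨0, A.2.1⟩ ⟨x, A.2.2⟩)) * ∑ j, ((x j : ℝ)) ^ 2) →
    PerfectScreening.NonSaturation := by
  intro hH hZ
  by_contra hNS
  apply hZ
  -- saturation along the axis
  simp only [PerfectScreening.NonSaturation, not_forall, Filter.not_frequently, not_lt] at hNS
  obtain ⟨ε, hε, hev⟩ := hNS
  obtain ⟨N, hN⟩ := Filter.eventually_atTop.1 hev
  -- shrink ε to ≤ 1
  set ε' : ℝ := min ε 1 with hε'
  have hε'pos : 0 < ε' := lt_min hε one_pos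
  have hε'1 : ε' ≤ 1 := min_le_right _ _
  have hsatAxis : ∀ n : ℕ, N ≤ n → ε' ≤ (n : ℝ) * criticalTwoPoint 3 (Pi.single 0 (n : ℤ)) :=
    fun n hn => (min_le_left _ _).trans (hN n hn)
  have hsat : ∀ w : Site 3, N ≤ Site.supNorm w → ε' ≤ 3 * (Site.supNorm w : ℝ) * criticalTwoPoint 3 w :=
    fun w hw => nonSatHeavyTail_pointwise hsatAxis (hw.trans (Nat.le_mul_of_pos_left _ (by norm_num)))
  -- `L` from item 4803
  obtain ⟨hsum, hzero, hnn, -, hconv⟩ :=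
    Summit.CriticalPhenomena.Ising3DConformalLimit.Theorems.PrecisionIsLaplacian_proof hH
  -- inputs on `G`
  obtain ⟨C₀, hC₀, hGenv'⟩ := exists_criticalTwoPoint_le_inv_pow (d := 3) le_rfl
  have hGenv : ∀ w : Site 3, w ≠ 0 → criticalTwoPoint 3 w ≤ C₀ / (Site.supNorm w : ℝ) := by
    intro w hw
    have h := hGenv' w hw
    simpa only [show (3 : ℕ) - 2 = 1 from rfl, pow_one, div_eq_mul_inv] using h
  have hβ : (0 : ℝ) ≤ criticalBeta 3 := criticalBeta_nonneg 3
  have hGperm : ∀ (σ : Equiv.Perm (Fin 3)) (x : Site 3),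
      criticalTwoPoint 3 (fun i => x (σ i)) = criticalTwoPoint 3 x :=
    fun σ x => twoPointPlus_perm_invariant_holds hβ σ x
  have hGflip : ∀ (j : Fin 3) (x : Site 3),
      criticalTwoPoint 3 (Function.update x j (-x j)) = criticalTwoPoint 3 x :=
    fun j x => twoPointPlus_reflection_invariant_holds hβ j x
  have hpos := quadForm_nonneg_of_posDef (criticalTwoPoint 3) (fun A => (hH A).1)
  exact summable_sq_of_saturation _ (criticalTwoPoint 3) C₀ ε' N hC₀ hε'pos hε'1 hsum hzero hnn hconv
    criticalTwoPoint_nonneg' criticalTwoPoint_le_one' criticalTwoPoint_neg hGperm hGflip hGenv hpos hsat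

/-- **Under `H`, NonSaturation (item 1342) ⟺ superdiffusivity of the OZ step law** (S1 p127888 + D2). [folklore] -/
theorem nonSaturation_iff_infiniteVariance :
    (∀ A : Finset (Site 3), (Matrix.of fun (p q : ↥A) => criticalTwoPoint 3 (q.1 - p.1)).PosDef ∧ ∀ u v : ↥A,
      (u ≠ v → (Matrix.of fun (p q : ↥A) => criticalTwoPoint 3 (q.1 - p.1))⁻¹ u v ≤ 0) ∧ 0 ≤ ∑ w, (Matrix.of
      fun (p q : ↥A) => criticalTwoPoint 3 (q.1 - p.1))⁻¹ u w) →
    (PerfectScreening.NonSaturation ↔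
    ¬ Summable (fun x : Site 3 => (⨅ A : {A : Finset (Site 3) // (0 : Site 3) ∈ A ∧ x ∈ A}, -((Matrix.of fun
      (p q : ↥A.1) => criticalTwoPoint 3 (q.1 - p.1))⁻¹ ⟨0, A.2.1⟩ ⟨x, A.2.2⟩)) * ∑ j, ((x j : ℝ)) ^ 2)) :=
  fun hH => ⟨stub_infiniteVarianceOfNonSaturation hH, stub_nonSaturationOfInfiniteVariance hH⟩

end Summit.CriticalPhenomena.Ising3DConformalLimit.Cruxes.DirectCorrelationStableTail.DiffusiveBranchIsNonsaturation

end
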